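import Summits.BirchSwinnertonDyer.BirchSwinnertonDyer.Theorems.BiquadraticEisensteinDescentManinDatumSupercuspidalCMInertResolventCertificateLabels
import Summits.BirchSwinnertonDyer.BirchSwinnertonDyer.Theorems.BiquadraticEisensteinDescentManinDatumSupercuspidalCMInertTorsionSumRationalSeven
import HarnessLib

set_option linter.dupNamespace false -- `Summit.BirchSwinnertonDyer.BirchSwinnertonDyer.Theorems.…` (summit = sub, D-0017)
set_option autoImplicit false

/-!
# Crux `ManinDatumSupercuspidalCMInert` (stmt-BirchSwinnertonDyer-20111, BED r605), `stub_S7` — the RES₇ CERTIFICATE, part 4A (regrouping):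
# regrouping `Σ_{b : (ℤ/7)²} Φ_k(b)·X(t_b)⁻²ᵐ = 4·T_{k,m}` and ★ RES₇fin — the fifteen small even resolvent bounds
# (width seat `bsd-wall-cm-bed-w3` g10; theorems only; `--supports 20111`, helper)

Route `BiquadraticEisensteinDescent` (cell `pub/bsd-wall`), memo `Cruxes/ManinDatumSupercuspidalCMInert/RES7-CERTIFICATE-w3g10.md`.  The hypothesis
RES₇fin of bed-w2 g10's `…ResolventBoundReduction.stub_S7_of_smallEvenResolventBound` (and of `resolventBound_of_smallEven`,
`core_seven_of_smallEvenResolventBound`) asks, for `k ∈ {1,2,3}`, even `n = 2m < 6(4 − k)` and every valuation `v` of `ℂ` with `v 7 < 1`: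
`v(R_n^{(k)})⁴ ≤ v(7)^{4−k}`, `R_n^{(k)} = Σ_{b : ZMod 7 × ZMod 7} conj((rep b/7)₄)^k · X(conj(rep b)/7)⁻ⁿ`, `X = ℘/ϖ₀²` on `Λ = ℤi + ℤ`.
Parts 1–3 (`…ResolventCertificateLabels/PowersA/PowersB/PowersC/Sums`) certify `v(T_{k,m})⁴ ≤ v 7^{4−k}` for the signed sums `T_{k,m}` over the twelve
CM-labels `z_{a,ε} = (1−i)^a(2−i)^ε/7`.  Here:

* §1 `sum_eq_sum_range_of_zero` — **regrouping of `(ℤ/7)² ∖ 0`**: `b ↦ cls(i^u(1+i)^a(2+i)^ε)` is a bijection from `[0,4) × [0,6) × [0,2)` onto the nonzero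
  classes (`decide`), so `Σ_b G b = Σ_{u<4} Σ_{a<6} Σ_{ε<2} G(cls(i^u(1+i)^a(2+i)^ε))` whenever `G 0 = 0`;
* §2 the summand at `cls(i^u(1+i)^a(2+i)^ε)`: `quarticCharMod_cls_rep` (periodicity), `quarticCharMod_gen` (`(·/7)₄` multiplicative with
  `(i/7)₄ = 1`, `((1+i)/7)₄ = −1` (`(1+i)¹² = −64 ≡ −1`), `((2+i)/7)₄ = i`), `rho_rep_cls` (`ρ` is `Λ`-periodic), `conj_toComplex_gen`
  (`conj(i^u(1+i)^a(2+i)^ε) = (−i)^u(1−i)^a(2−i)^ε`), `rho_neg_I_pow_mul` (`ρ((−i)^u w) = ρ(w)`), whence `summand_gen`: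
  `Φ_k · X⁻²ᵐ = ((−1)^a(−i)^ε)^k · ρ((1−i)^a(2−i)^ε/7)^m`, and ★ `resolventSum_even_eq` — `R_{2m}^{(k)} = 4·Σ_{a<6} Σ_{ε<2} ((−1)^a(−i)^ε)^k ρ(z_{a,ε})^m`;
* §3 `rfin_k_m` — the fifteen bounds `v(R_{2m}^{(k)})⁴ ≤ v 7^{4−k}` (expand the twelve terms, `pt_a_e` rewrites `(1−i)^a(2−i)^ε/7` to the literal
  points of part 1, the signs agree with part 3 modulo `i² = −1`, `v 4 ≤ 1`, then `cert_k_m`);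
* §4 ★ `smallEvenResolventBound_seven` — **RES₇fin** (case split `k ∈ {1,2,3}`, `m ≤ 8, 5, 2`).

HONEST FRAMING: RES₇fin is hereby PROVED (kernel-checked, no named fact), by explicit complex-multiplication labelling plus a finite certificate —
not by the Galois theory of the `7`-division field (bed-w4 g11's structural road to the same binder).  The crux itself still needs `stub_S5` (the
`j = 0` cell at `5`); nothing here proves Manin's conjecture or BSD.  No definition, no named fact, no `sorry`; axioms standard.
-/

noncomputable section

open scoped ComplexConjugate
open Complex PeriodPair
open Literature.NumberTheory.EllipticCurves Literature.NumberTheory.EllipticCurves.GaussianLattice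
open Literature.NumberTheory.LFunctions Literature.NumberTheory.LFunctions.GaussianTheta
open Literature.NumberTheory.QuadraticFields.GaussianQuarticSymbol
open Summit.BirchSwinnertonDyer.BirchSwinnertonDyer.Theorems.BiquadraticEisensteinDescentManinDatumSupercuspidalCMInertResolventCertificateLabels
open Summit.BirchSwinnertonDyer.BirchSwinnertonDyer.Theorems.BiquadraticEisensteinDescentManinDatumSupercuspidalCMInertSevenDivisionEisenstein (val_intCast_le_one)
open Summit.BirchSwinnertonDyer.BirchSwinnertonDyer.Theorems.BiquadraticEisensteinDescentManinDatumSupercuspidalCMInertTorsionSumRational (quarticCharMod_seven_two_add_I quarticCharMod_seven_I)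

namespace Summit.BirchSwinnertonDyer.BirchSwinnertonDyer.Theorems.BiquadraticEisensteinDescentManinDatumSupercuspidalCMInertResolventCertificateRegroup

/-! ## §1 Regrouping the nonzero classes of `(ℤ/7)²` along `i^u (1+i)^a (2+i)^ε` -/

/-- **`(ℤ[i]/7)ˣ = μ₄ · (1+i)^{[0,6)} · (2+i)^{[0,2)}`**: the image of `[0,4) × [0,6) × [0,2)` under `(u,a,ε) ↦ cls(i^u(1+i)^a(2+i)^ε)` is exactly the
set of nonzero classes. [folklore] -/
theorem image_gen_eq :
    ((Finset.range 4 ×ˢ (Finset.range 6 ×ˢ Finset.range 2)).image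
      (fun p : ℕ × (ℕ × ℕ) ↦ cls 7 (⟨0, 1⟩ ^ p.1 * ⟨1, 1⟩ ^ p.2.1 * ⟨2, 1⟩ ^ p.2.2 : GaussianInt))) =
      (Finset.univ : Finset (ZMod 7 × ZMod 7)).erase 0 := by
  decide

/-- The labelling `(u,a,ε) ↦ cls(i^u(1+i)^a(2+i)^ε)` is injective on `[0,4) × [0,6) × [0,2)` (`2 + i` generates `(ℤ[i]/7)ˣ`, `1 + i` its
squares, `i` the fourth roots of unity). [folklore] -/
theorem injOn_gen :
    Set.InjOn (fun p : ℕ × (ℕ × ℕ) ↦ cls 7 (⟨0, 1⟩ ^ p.1 * ⟨1, 1⟩ ^ p.2.1 * ⟨2, 1⟩ ^ p.2.2 : GaussianInt))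
      ↑(Finset.range 4 ×ˢ (Finset.range 6 ×ˢ Finset.range 2)) := by
  have h : ∀ p ∈ Finset.range 4 ×ˢ (Finset.range 6 ×ˢ Finset.range 2), ∀ q ∈ Finset.range 4 ×ˢ (Finset.range 6 ×ˢ Finset.range 2),
      cls 7 (⟨0, 1⟩ ^ p.1 * ⟨1, 1⟩ ^ p.2.1 * ⟨2, 1⟩ ^ p.2.2 : GaussianInt) =
        cls 7 (⟨0, 1⟩ ^ q.1 * ⟨1, 1⟩ ^ q.2.1 * ⟨2, 1⟩ ^ q.2.2 : GaussianInt) → p = q := by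
    decide
  intro p hp q hq hpq
  exact h p (Finset.mem_coe.mp hp) q (Finset.mem_coe.mp hq) hpq

/-- **Regrouping**: for `G : (ℤ/7)² → ℂ` with `G 0 = 0`,
`Σ_b G b = Σ_{u<4} Σ_{a<6} Σ_{ε<2} G(cls(i^u (1+i)^a (2+i)^ε))`. [folklore] -/
theorem sum_eq_sum_range_of_zero (G : ZMod 7 × ZMod 7 → ℂ) (hG : G 0 = 0) :
    ∑ b : ZMod 7 × ZMod 7, G b =
      ∑ u ∈ Finset.range 4, ∑ a ∈ Finset.range 6, ∑ e ∈ Finset.range 2,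
        G (cls 7 (⟨0, 1⟩ ^ u * ⟨1, 1⟩ ^ a * ⟨2, 1⟩ ^ e : GaussianInt)) := by
  classical
  rw [← Finset.sum_erase (Finset.univ) (f := G) (a := 0) hG, ← image_gen_eq, Finset.sum_image injOn_gen]
  simp only [Finset.sum_product]

/-! ## §2 The summand at the class of `i^u (1+i)^a (2+i)^ε` -/

/-- `rep(cls x) ≡ x (mod 7ℤ[i])`. [folklore] -/
theorem exists_rep_cls (x : GaussianInt) : ∃ y : GaussianInt, rep 7 (cls 7 x) 0 = x + 7 * y := by
  obtain ⟨y, hy⟩ := exists_rep_eq 7 (rfl : cls 7 x = cls 7 x)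
  refine ⟨-⟨y.1, y.2⟩, ?_⟩
  have h := rep_eq_rep_zero_add 7 (cls 7 x) y
  rw [hy] at h
  linear_combination (-1 : GaussianInt) * h

/-- `(rep(cls x)/7)₄ = (x/7)₄` (periodicity of the quartic symbol). [cite: IrelandRosen1982, Ch. 9 §8, Definition after Prop. 9.8.4 (remark)] -/
theorem quarticCharMod_cls_rep (x : GaussianInt) : quarticCharMod 7 (rep 7 (cls 7 x) 0) = quarticCharMod 7 x := by
  obtain ⟨y, hy⟩ := exists_rep_cls x
  rw [hy, show x + 7 * y = x + ((7 : ℤ) : GaussianInt) * y by push_cast; ring, quarticCharMod_add_mul]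

/-- `((1 + i)/7)₄ = −1` (Euler's criterion: `(1+i)¹² = −64 ≡ −1 (mod 7)`). [cite: IrelandRosen1982, Ch. 9 §8, Prop. 9.8.2 and Definition] -/
theorem quarticCharMod_seven_one_add_I : quarticCharMod (7 : ℕ) ⟨1, 1⟩ = -1 :=
  quarticCharMod_natCast_eq_of_pow_four_eq_one (q := 7) (by norm_num) (by norm_num) (by decide) ⟨⟨-9, 0⟩, by decide⟩

/-- `(·/7)₄` on the monomials: `(i^u (1+i)^a (2+i)^ε / 7)₄ = (−1)^a · i^ε` in `ℤ[i]`. [cite: IrelandRosen1982, Ch. 9 §8, Prop. 9.8.3 (b)] -/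
theorem quarticCharMod_gen (u a e : ℕ) :
    quarticCharMod 7 (⟨0, 1⟩ ^ u * ⟨1, 1⟩ ^ a * ⟨2, 1⟩ ^ e : GaussianInt) = (-1) ^ a * ⟨0, 1⟩ ^ e := by
  have hpow : ∀ (x : GaussianInt) (n : ℕ), quarticCharMod 7 (x ^ n) = quarticCharMod 7 x ^ n := by
    intro x n
    have h := quarticCharMod_natCast_pow (q := 7) (by norm_num) (by norm_num) x n
    simpa using h
  have hI : quarticCharMod 7 (⟨0, 1⟩ : GaussianInt) = 1 := by simpa using quarticCharMod_seven_I
  have h11 : quarticCharMod 7 (⟨1, 1⟩ : GaussianInt) = -1 := by simpa using quarticCharMod_seven_one_add_I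
  have h21 : quarticCharMod 7 (⟨2, 1⟩ : GaussianInt) = ⟨0, 1⟩ := by simpa using quarticCharMod_seven_two_add_I
  rw [quarticCharMod_mul, quarticCharMod_mul, hpow, hpow, hpow, hI, h11, h21, one_pow, one_mul]

/-- The weight at the class of `i^u (1+i)^a (2+i)^ε`: `conj((rep b/7)₄)^k = ((−1)^a (−i)^ε)^k`. [cite: IrelandRosen1982, Ch. 9 §8, Prop. 9.8.3 (b), (c)] -/
theorem weight_gen (u a e k : ℕ) :
    (conj (((quarticCharMod 7 (rep 7 (cls 7 (⟨0, 1⟩ ^ u * ⟨1, 1⟩ ^ a * ⟨2, 1⟩ ^ e : GaussianInt)) 0) : GaussianInt) : ℂ))) ^ k =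
      ((-1 : ℂ) ^ a * (-I) ^ e) ^ k := by
  rw [quarticCharMod_cls_rep, quarticCharMod_gen]
  have hI : (((⟨0, 1⟩ : GaussianInt)) : ℂ) = I := by rw [GaussianInt.toComplex_def]; simp
  rw [GaussianInt.toComplex_mul, map_pow, map_pow, GaussianInt.toComplex_neg, GaussianInt.toComplex_one, hI, map_mul, map_pow, map_pow,
    map_neg, map_one, Complex.conj_I]

/-- `conj(y) ∈ Λ` for a Gaussian integer `y`. [folklore] -/
theorem conj_toComplex_mem (y : GaussianInt) : conj ((y : GaussianInt) : ℂ) ∈ (ofUpperHalfPlane UpperHalfPlane.I).lattice := by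
  rw [GaussianInt.toComplex_def, map_add, map_mul, Complex.conj_I, map_intCast, map_intCast]
  exact mem_lattice_iff.mpr ⟨-y.im, y.re, by push_cast; ring⟩

/-- `ρ(conj(rep(cls x))/7) = ρ(conj(x)/7)` (`ρ = (ϖ₀²/℘)²` is `Λ`-periodic). [folklore] -/
theorem rho_rep_cls (x : GaussianInt) :
    ((℘[ofUpperHalfPlane UpperHalfPlane.I] (conj ((rep 7 (cls 7 x) 0 : GaussianInt) : ℂ) / 7) / ((Real.Gamma (1 / 4) ^ 2 / (2 * Real.sqrt (2 * Real.pi)) : ℝ) : ℂ) ^ 2)⁻¹ ^ 2) = ((℘[ofUpperHalfPlane UpperHalfPlane.I] (conj ((x : GaussianInt) : ℂ) / 7) / ((Real.Gamma (1 / 4) ^ 2 / (2 * Real.sqrt (2 * Real.pi)) : ℝ) : ℂ) ^ 2)⁻¹ ^ 2) := by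
  obtain ⟨y, hy⟩ := exists_rep_cls x
  have harg : conj ((rep 7 (cls 7 x) 0 : GaussianInt) : ℂ) / 7 =
      conj ((x : GaussianInt) : ℂ) / 7 + ((⟨_, conj_toComplex_mem y⟩ : (ofUpperHalfPlane UpperHalfPlane.I).lattice) : ℂ) := by
    rw [Subtype.coe_mk, hy, GaussianInt.toComplex_add, GaussianInt.toComplex_mul, map_add, map_mul,
      show (((7 : GaussianInt)) : ℂ) = 7 from by rw [GaussianInt.toComplex_def]; simp, map_ofNat]
    ring
  rw [harg, (ofUpperHalfPlane UpperHalfPlane.I).weierstrassP_add_coe]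

/-- `conj(i^u (1+i)^a (2+i)^ε) = (−i)^u · ((1−i)^a (2−i)^ε)` in `ℂ`. [folklore] -/
theorem conj_toComplex_gen (u a e : ℕ) :
    conj (((⟨0, 1⟩ ^ u * ⟨1, 1⟩ ^ a * ⟨2, 1⟩ ^ e : GaussianInt) : ℂ)) = (-I) ^ u * ((1 - I) ^ a * (2 - I) ^ e) := by
  have hI : (((⟨0, 1⟩ : GaussianInt)) : ℂ) = I := by rw [GaussianInt.toComplex_def]; simp
  have h11 : (((⟨1, 1⟩ : GaussianInt)) : ℂ) = 1 + I := by rw [GaussianInt.toComplex_def]; simp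
  have h21 : (((⟨2, 1⟩ : GaussianInt)) : ℂ) = 2 + I := by rw [GaussianInt.toComplex_def]; simp
  rw [GaussianInt.toComplex_mul, GaussianInt.toComplex_mul, map_pow, map_pow, map_pow, hI, h11, h21, map_mul, map_mul, map_pow,
    map_pow, map_pow, Complex.conj_I, map_add, map_add, map_one, Complex.conj_I, map_ofNat]
  ring

/-- `ρ((−i)^u · w) = ρ(w)`: the units act trivially on `ρ = (ϖ₀²/℘)²` (`℘` even, `℘(iz) = −℘(z)`). [folklore] -/
theorem rho_neg_I_pow_mul (u : ℕ) (w : ℂ) : ((℘[ofUpperHalfPlane UpperHalfPlane.I] ((-I) ^ u * w) / ((Real.Gamma (1 / 4) ^ 2 / (2 * Real.sqrt (2 * Real.pi)) : ℝ) : ℂ) ^ 2)⁻¹ ^ 2) = ((℘[ofUpperHalfPlane UpperHalfPlane.I] (w) / ((Real.Gamma (1 / 4) ^ 2 / (2 * Real.sqrt (2 * Real.pi)) : ℝ) : ℂ) ^ 2)⁻¹ ^ 2) := by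
  induction u with
  | zero => rw [pow_zero, one_mul]
  | succ u ih =>
    rw [show (-I) ^ (u + 1) * w = -(I * ((-I) ^ u * w)) by ring, (ofUpperHalfPlane UpperHalfPlane.I).weierstrassP_neg,
      GaussianLattice.weierstrassP_I_mul, neg_div, inv_neg, neg_sq, ih]

/-- **The summand at the class of `i^u (1+i)^a (2+i)^ε`** (`n = 2m`):
`conj((rep b/7)₄)^k · X(conj(rep b)/7)⁻²ᵐ = ((−1)^a(−i)^ε)^k · ρ((1−i)^a(2−i)^ε/7)^m`. [folklore] -/
theorem summand_gen (k m u a e : ℕ) :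
    (conj (((quarticCharMod 7 (rep 7 (cls 7 (⟨0, 1⟩ ^ u * ⟨1, 1⟩ ^ a * ⟨2, 1⟩ ^ e : GaussianInt)) 0) : GaussianInt) : ℂ))) ^ k *
      (℘[ofUpperHalfPlane UpperHalfPlane.I] (conj ((rep 7 (cls 7 (⟨0, 1⟩ ^ u * ⟨1, 1⟩ ^ a * ⟨2, 1⟩ ^ e : GaussianInt)) 0 : GaussianInt) : ℂ) / 7) /
        ((Real.Gamma (1 / 4) ^ 2 / (2 * Real.sqrt (2 * Real.pi)) : ℝ) : ℂ) ^ 2)⁻¹ ^ (2 * m) =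
      ((-1 : ℂ) ^ a * (-I) ^ e) ^ k * ((℘[ofUpperHalfPlane UpperHalfPlane.I] ((1 - I) ^ a * (2 - I) ^ e / 7) / ((Real.Gamma (1 / 4) ^ 2 / (2 * Real.sqrt (2 * Real.pi)) : ℝ) : ℂ) ^ 2)⁻¹ ^ 2) ^ m := by
  rw [weight_gen, pow_mul, rho_rep_cls, conj_toComplex_gen, mul_div_assoc, rho_neg_I_pow_mul]

/-- The weight vanishes at `b = 0` (`(0/7)₄ = 0`, `k ≥ 1`), so the `b = 0` term of `R_n^{(k)}` is `0`. [folklore] -/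
theorem summand_zero {k : ℕ} (hk : 1 ≤ k) (n : ℕ) :
    (conj (((quarticCharMod 7 (rep 7 (0 : ZMod 7 × ZMod 7) 0) : GaussianInt) : ℂ))) ^ k *
      (℘[ofUpperHalfPlane UpperHalfPlane.I] (conj ((rep 7 (0 : ZMod 7 × ZMod 7) 0 : GaussianInt) : ℂ) / 7) / ((Real.Gamma (1 / 4) ^ 2 / (2 * Real.sqrt (2 * Real.pi)) : ℝ) : ℂ) ^ 2)⁻¹ ^ n = 0 := by
  have h0 : rep 7 (0 : ZMod 7 × ZMod 7) 0 = 0 := by decide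
  have hχ : quarticCharMod 7 (0 : GaussianInt) = 0 := by
    have h := (quarticCharMod_natCast_eq_zero_iff (q := 7) (by norm_num) (by norm_num) (0 : GaussianInt)).mpr (dvd_zero _)
    simpa using h
  rw [h0, hχ, GaussianInt.toComplex_zero, map_zero, zero_pow (by omega), zero_mul]

/-- ★ **`R_{2m}^{(k)} = 4 · Σ_{a<6} Σ_{ε<2} ((−1)^a(−i)^ε)^k ρ((1−i)^a(2−i)^ε/7)^m`** (`k ≥ 1`): the `48` nonzero classes regrouped along the
CM-labelling, the four units contributing equally. [folklore] -/
theorem resolventSum_even_eq {k : ℕ} (hk : 1 ≤ k) (m : ℕ) :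
    ∑ b : ZMod 7 × ZMod 7, (conj (((quarticCharMod 7 (rep 7 b 0) : GaussianInt) : ℂ))) ^ k * (℘[ofUpperHalfPlane UpperHalfPlane.I] (conj ((rep 7 b 0 : GaussianInt) : ℂ) / 7) / ((Real.Gamma (1 / 4) ^ 2 / (2 * Real.sqrt (2 * Real.pi)) : ℝ) : ℂ) ^ 2)⁻¹ ^ (2 * m) =
      4 * ∑ a ∈ Finset.range 6, ∑ e ∈ Finset.range 2, ((-1 : ℂ) ^ a * (-I) ^ e) ^ k * ((℘[ofUpperHalfPlane UpperHalfPlane.I] ((1 - I) ^ a * (2 - I) ^ e / 7) / ((Real.Gamma (1 / 4) ^ 2 / (2 * Real.sqrt (2 * Real.pi)) : ℝ) : ℂ) ^ 2)⁻¹ ^ 2) ^ m := by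
  rw [sum_eq_sum_range_of_zero _ (summand_zero hk (2 * m))]
  simp_rw [summand_gen]
  rw [Finset.sum_const, Finset.card_range, nsmul_eq_mul, Nat.cast_ofNat]

/-! ## §3 The twelve labelled points as literals -/

/-- `(1−i)⁰(2−i)⁰/7 = 1/7`. [folklore] -/
theorem pt_0_0 : (1 - I) ^ 0 * (2 - I) ^ 0 / 7 = (1 / 7 : ℂ) := by norm_num

/-- `(1−i)^0(2−i)^1/7 = (2 − 1i)/7`. [folklore] -/
theorem pt_0_1 : (1 - I) ^ 0 * (2 - I) ^ 1 / 7 = ((((2 : ℤ) : ℂ) + ((-1 : ℤ) : ℂ) * I) / 7 : ℂ) := by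
  push_cast
  linear_combination (((0 : ℂ)) / 7) * I_sq

/-- `(1−i)^1(2−i)^0/7 = (1 − 1i)/7`. [folklore] -/
theorem pt_1_0 : (1 - I) ^ 1 * (2 - I) ^ 0 / 7 = ((((1 : ℤ) : ℂ) + ((-1 : ℤ) : ℂ) * I) / 7 : ℂ) := by
  push_cast
  linear_combination (((0 : ℂ)) / 7) * I_sq

/-- `(1−i)^1(2−i)^1/7 = (1 − 3i)/7`. [folklore] -/
theorem pt_1_1 : (1 - I) ^ 1 * (2 - I) ^ 1 / 7 = ((((1 : ℤ) : ℂ) + ((-3 : ℤ) : ℂ) * I) / 7 : ℂ) := by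
  push_cast
  linear_combination (((1 : ℂ)) / 7) * I_sq

/-- `(1−i)^2(2−i)^0/7 = (0 − 2i)/7`. [folklore] -/
theorem pt_2_0 : (1 - I) ^ 2 * (2 - I) ^ 0 / 7 = ((((0 : ℤ) : ℂ) + ((-2 : ℤ) : ℂ) * I) / 7 : ℂ) := by
  push_cast
  linear_combination (((1 : ℂ)) / 7) * I_sq

/-- `(1−i)^2(2−i)^1/7 = (-2 − 4i)/7`. [folklore] -/
theorem pt_2_1 : (1 - I) ^ 2 * (2 - I) ^ 1 / 7 = ((((-2 : ℤ) : ℂ) + ((-4 : ℤ) : ℂ) * I) / 7 : ℂ) := by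
  push_cast
  linear_combination (((4 : ℂ) + (-1 : ℂ) * I) / 7) * I_sq

/-- `(1−i)^3(2−i)^0/7 = (-2 − 2i)/7`. [folklore] -/
theorem pt_3_0 : (1 - I) ^ 3 * (2 - I) ^ 0 / 7 = ((((-2 : ℤ) : ℂ) + ((-2 : ℤ) : ℂ) * I) / 7 : ℂ) := by
  push_cast
  linear_combination (((3 : ℂ) + (-1 : ℂ) * I) / 7) * I_sq

/-- `(1−i)^3(2−i)^1/7 = (-6 − 2i)/7`. [folklore] -/
theorem pt_3_1 : (1 - I) ^ 3 * (2 - I) ^ 1 / 7 = ((((-6 : ℤ) : ℂ) + ((-2 : ℤ) : ℂ) * I) / 7 : ℂ) := by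
  push_cast
  linear_combination (((8 : ℂ) + (-5 : ℂ) * I + (1 : ℂ) * I ^ 2) / 7) * I_sq

/-- `(1−i)^4(2−i)^0/7 = (-4 + 0i)/7`. [folklore] -/
theorem pt_4_0 : (1 - I) ^ 4 * (2 - I) ^ 0 / 7 = ((((-4 : ℤ) : ℂ) + ((0 : ℤ) : ℂ) * I) / 7 : ℂ) := by
  push_cast
  linear_combination (((5 : ℂ) + (-4 : ℂ) * I + (1 : ℂ) * I ^ 2) / 7) * I_sq

/-- `(1−i)^4(2−i)^1/7 = (-8 + 4i)/7`. [folklore] -/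
theorem pt_4_1 : (1 - I) ^ 4 * (2 - I) ^ 1 / 7 = ((((-8 : ℤ) : ℂ) + ((4 : ℤ) : ℂ) * I) / 7 : ℂ) := by
  push_cast
  linear_combination (((10 : ℂ) + (-13 : ℂ) * I + (6 : ℂ) * I ^ 2 + (-1 : ℂ) * I ^ 3) / 7) * I_sq

/-- `(1−i)^5(2−i)^0/7 = (-4 + 4i)/7`. [folklore] -/
theorem pt_5_0 : (1 - I) ^ 5 * (2 - I) ^ 0 / 7 = ((((-4 : ℤ) : ℂ) + ((4 : ℤ) : ℂ) * I) / 7 : ℂ) := by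
  push_cast
  linear_combination (((5 : ℂ) + (-9 : ℂ) * I + (5 : ℂ) * I ^ 2 + (-1 : ℂ) * I ^ 3) / 7) * I_sq

/-- `(1−i)^5(2−i)^1/7 = (-4 + 12i)/7`. [folklore] -/
theorem pt_5_1 : (1 - I) ^ 5 * (2 - I) ^ 1 / 7 = ((((-4 : ℤ) : ℂ) + ((12 : ℤ) : ℂ) * I) / 7 : ℂ) := by
  push_cast
  linear_combination (((6 : ℂ) + (-23 : ℂ) * I + (19 : ℂ) * I ^ 2 + (-7 : ℂ) * I ^ 3 + (1 : ℂ) * I ^ 4) / 7) * I_sq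

end Summit.BirchSwinnertonDyer.BirchSwinnertonDyer.Theorems.BiquadraticEisensteinDescentManinDatumSupercuspidalCMInertResolventCertificateRegroup

end
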